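import Summits.AtomisticToContinuum.Crystallization.Theorems.ExcessDecayLiouvilleEquationFlux
import Summits.AtomisticToContinuum.Crystallization.Theorems.ExcessDecayLiouvilleSelfForce
import Summits.AtomisticToContinuum.Crystallization.Theorems.ExcessDecayLiouvilleEquationBounds
import Summits.AtomisticToContinuum.Crystallization.Theorems.ExcessDecayLiouvilleCaccioppoliLocalWeights

/-!
# Route `ExcessDecayLiouville`: rows of the cut-off displacement relative to a relaxed approximant (nonlinear half, VII)

Harmonic-replacement architecture for item `ExcessDecay` (stmt-AtomisticToContinuum-9334), nonlinear half.
For the matched displacement `u = π x − x`, an affine-plus-shift approximant `g` and a site cut-off `χ`, the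
field `v = χ·f̃`, `f̃ = u − g`, has operator rows in forcing-plus-antisymmetric-flux form at every site `s`
of `B_r(c)` with `χ s = 1` (`rows_identity`, a rearrangement of `opRow_cutoff_identity`):

`(L v)(s) = φ s + Σ_{q ∈ SR∖s} Φ s q`,  `Φ s q = −(R(s−q, Dg + Df̃) − R(s−q, Dg))`,
`φ s = −Σ_{SR∖s} F((s−q) + Dg) − Rest(s) + Tχ(s)`.

* `flux_antisymm` : `Φ q s = −Φ s q`;
* `norm_flux_le` : `‖Φ s q‖ ≤ Λ (dist s q)⁻⁸ ‖f̃ s − f̃ q‖`, `Λ = 210000((25/23)(D₀ + ‖a 0 − a 1‖) + ‖B‖)`;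
* `norm_selfForce_trunc_le` : for a RELAXED `g` (no self-force) the truncated self-force sum is a far tail,
  `‖Σ_{SR∖s} F((s−q)+Dg)‖ ≤ 31488·1024/((23/25)³ (r − dist s c)⁴)`;
* `norm_cutoffTail_le` : the two `χ`-tails are `≤ 38 D (F₈(ϱ) + F₈(r − dist s c))` when `1 − χ` vanishes on
  `B_{dist s c + ϱ}(c)`-sites... (stated with an abstract radius `ϱ` beyond which `χ = 1` fails).

All `[folklore]`; helper lemmas, nothing here closes an item.
-/

noncomputable section

namespace Summit.AtomisticToContinuum.Crystallization.Theorems.ExcessDecayLiouville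

open scoped BigOperators Topology InnerProductSpace RealInnerProductSpace Classical
open Literature.MathematicalPhysics.StatisticalMechanics
open Summit.AtomisticToContinuum.Crystallization.Theorems.PhononStabilityNegative

-- Local notation: the force-constant map `K(e)w = h(|e|²)w + 2⟪e,w⟫h′(|e|²)e`.
local notation3 "𝕂[" e "] " w:max =>
  (-((‖e‖ ^ 2)⁻¹) ^ 7 + ((‖e‖ ^ 2)⁻¹) ^ 4) • w + (2 * ⟪e, w⟫ * (7 * ((‖e‖ ^ 2)⁻¹) ^ 8 - 4 * ((‖e‖ ^ 2)⁻¹) ^ 5)) • e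
-- Local notation: the pair force `F(x) = h(|x|²) x`.
local notation3 "𝐅[" x "]" => ((-((‖x‖ ^ 2)⁻¹) ^ 7 + ((‖x‖ ^ 2)⁻¹) ^ 4) • x)
-- Local notation: the remainder `R(e, w) = F(e + w) − F(e) − K(e) w`.
local notation3 "ℛ[" e ", " w "]" => (𝐅[e + w] - 𝐅[e] - 𝕂[e] w)

section

variable {X : Set (EuclideanSpace ℝ (Fin 3))} {c : EuclideanSpace ℝ (Fin 3)} {r ε : ℝ}
  {t : Fin 2 → EuclideanSpace ℝ (Fin 3)} {A : EuclideanSpace ℝ (Fin 3) →L[ℝ] EuclideanSpace ℝ (Fin 3)}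
  {π : EuclideanSpace ℝ (Fin 3) → EuclideanSpace ℝ (Fin 3)}
  {aff : (EuclideanSpace ℝ (Fin 3)) → (EuclideanSpace ℝ (Fin 3))} {a : Fin 2 → EuclideanSpace ℝ (Fin 3)}
  {B : (EuclideanSpace ℝ (Fin 3)) →L[ℝ] (EuclideanSpace ℝ (Fin 3))} {x₀ : EuclideanSpace ℝ (Fin 3)}

set_option quotPrecheck false in
-- Local notation: the operator row `(L v)(p)`.
local notation "𝕃" v:max " @ " p:max =>
  tsum (fun q : Sites₀ t A => (if ((p : Sites₀ t A) : EuclideanSpace ℝ (Fin 3)) ≠ q then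
    𝕂[((p : Sites₀ t A) : EuclideanSpace ℝ (Fin 3)) - q] (v ((p : Sites₀ t A) : EuclideanSpace ℝ (Fin 3)) - v q) else 0))

/-! ## The rows -/

/-- **Rows of `χ·((π x − x) − g x)` in forcing-plus-flux form** (rearrangement of `opRow_cutoff_identity`).
[folklore] -/
theorem rows_identity (hA : Adm₀ A) (hI : Inner₀ t A) (hX : X.Finite)
    (hπ : ∀ s' ∈ Sites₀ t A, dist s' c ≤ r → π s' ∈ X ∧ dist (π s') s' ≤ ε)
    (hinj : ∀ s₁ ∈ Sites₀ t A, ∀ s₂ ∈ Sites₀ t A, dist s₁ c ≤ r → dist s₂ c ≤ r → π s₁ = π s₂ → s₁ = s₂)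
    {s : EuclideanSpace ℝ (Fin 3)} (hs : s ∈ Sites₀ t A) (hsc : dist s c ≤ r)
    (SR : Finset (EuclideanSpace ℝ (Fin 3))) (hSR : ∀ x, x ∈ SR ↔ x ∈ Sites₀ t A ∧ dist x c ≤ r)
    (hEq : HasSum (fun q : {q : EuclideanSpace ℝ (Fin 3) // q ∈ X ∧ q ≠ π s} =>
      (deriv lennardJones (dist (π s) q) / dist (π s) q) • (π s - (q : EuclideanSpace ℝ (Fin 3)))) 0)
    (g : EuclideanSpace ℝ (Fin 3) → EuclideanSpace ℝ (Fin 3)) (χ : EuclideanSpace ℝ (Fin 3) → ℝ) (hχs : χ s = 1)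
    (hχ0 : ∀ q ∈ Sites₀ t A, q ∉ SR → χ q = 0)
    (hv : (Function.support (fun x => χ x • ((π x - x) - g x))).Finite) :
    𝕃 (fun x => χ x • ((π x - x) - g x)) @ (⟨s, hs⟩ : Sites₀ t A) =
      (-(∑ s' ∈ SR.erase s, 𝐅[(s - s') + (g s - g s')]) -
        (∑ q ∈ (hX.toFinset.erase (π s)) \ ((SR.erase s).image π),
          (deriv lennardJones (dist (π s) q) / dist (π s) q) • (π s - q)) +
        ((∑ s' ∈ SR.erase s, 𝕂[s - s'] ((1 - χ s') • ((π s' - s') - g s'))) +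
          ∑' q : ↑((SR.subtype (· ∈ Sites₀ t A) : Set (Sites₀ t A)))ᶜ,
            (if s ≠ (q : EuclideanSpace ℝ (Fin 3)) then 𝕂[s - (q : EuclideanSpace ℝ (Fin 3))] ((π s - s) - g s) else 0))) +
      ∑ s' ∈ SR.erase s, (-(ℛ[s - s', (g s - g s') + (((π s - s) - g s) - ((π s' - s') - g s'))] -
        ℛ[s - s', g s - g s'])) := by
  rw [opRow_cutoff_identity hA hI hX hπ hinj hs hsc SR hSR hEq g χ hχs hχ0 hv, Finset.sum_neg_distrib]
  abel

/-- **The flux is antisymmetric.** [folklore] -/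
theorem flux_antisymm (g u : EuclideanSpace ℝ (Fin 3) → EuclideanSpace ℝ (Fin 3)) (s q : EuclideanSpace ℝ (Fin 3)) :
    (-(ℛ[q - s, (g q - g s) + (u q - u s)] - ℛ[q - s, g q - g s])) =
      -(-(ℛ[s - q, (g s - g q) + (u s - u q)] - ℛ[s - q, g s - g q])) := by
  have e1 : q - s = -(s - q) := by abel
  have e2 : (g q - g s) + (u q - u s) = -((g s - g q) + (u s - u q)) := by abel
  have e3 : g q - g s = -(g s - g q) := by abel
  rw [e1, e2, e3, remainder_antisymm, remainder_antisymm]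
  abel

/-- **The flux is dominated by the displacement differences**: for sites `s ≠ q` with `dist s q ≤ 2r'`,
an affine-plus-shift `g` (`‖a 0 − a 1‖ + 2r'‖B‖ ≤ 1/50`) and displacements `‖u x‖ ≤ D₀/2 ≤ 1/20`,
`‖Φ s q‖ ≤ 210000((25/23)(D₀ + ‖a 0 − a 1‖) + ‖B‖) (dist s q)⁻⁸ ‖u s − u q‖`. [folklore] -/
theorem norm_flux_le (hA : Adm₀ A) (hI : Inner₀ t A)
    (haff : ∀ (m : Fin 2) (z : EuclideanSpace ℝ (Fin 3)), z ∈ Λ₀ → aff (t m + A z) = a m + B (t m + A z - x₀))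
    {r' D₀ : ℝ} (hD₀ : 0 ≤ D₀) (hD₀' : D₀ ≤ 1 / 10) (hsmall : ‖a 0 - a 1‖ + 2 * r' * ‖B‖ ≤ 1 / 50)
    (u : EuclideanSpace ℝ (Fin 3) → EuclideanSpace ℝ (Fin 3)) {s q : EuclideanSpace ℝ (Fin 3)}
    (hs : s ∈ Sites₀ t A) (hq : q ∈ Sites₀ t A) (hsq : s ≠ q) (hdist : dist s q ≤ 2 * r')
    (hus : ‖u s‖ ≤ D₀ / 2) (huq : ‖u q‖ ≤ D₀ / 2) :
    ‖-(ℛ[s - q, (aff s - aff q) + (u s - u q)] - ℛ[s - q, aff s - aff q])‖ ≤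
      210000 * ((25 / 23) * (D₀ + ‖a 0 - a 1‖) + ‖B‖) * (dist s q)⁻¹ ^ 8 * ‖u s - u q‖ := by
  have he : 23 / 25 ≤ ‖s - q‖ := by rw [← dist_eq_norm]; exact dist_sites_ge hA hI hs hq hsq
  have he0 : 0 < ‖s - q‖ := by linarith
  have hBn : 0 ≤ ‖B‖ := norm_nonneg _
  have ha01 : 0 ≤ ‖a 0 - a 1‖ := norm_nonneg _
  have hr' : 0 ≤ 2 * r' := le_trans dist_nonneg hdist
  -- the affine difference
  have hga : ‖aff s - aff q‖ ≤ ‖a 0 - a 1‖ + ‖B‖ * ‖s - q‖ :=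
    norm_affine_sub_le (t := t) (A := A) haff ⟨s, hs⟩ ⟨q, hq⟩
  have hga' : ‖aff s - aff q‖ ≤ 1 / 50 := by
    have h1 : ‖B‖ * ‖s - q‖ ≤ ‖B‖ * (2 * r') := by
      rw [← dist_eq_norm]; exact mul_le_mul_of_nonneg_left hdist hBn
    nlinarith
  have hd : ‖u s - u q‖ ≤ D₀ := (norm_sub_le _ _).trans (by linarith)
  have h := norm_remainder_split_le' he hga' (hd.trans hD₀')
  rw [norm_neg]
  refine h.trans ?_
  -- 210000 |e|⁻⁹ (‖d‖ + ‖a‖) ‖d‖ ≤ Λ |e|⁻⁸ ‖d‖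
  have hi0 : 0 ≤ ‖s - q‖⁻¹ := inv_nonneg.2 he0.le
  have hi1 : ‖s - q‖⁻¹ ≤ 25 / 23 := by rw [inv_le_comm₀ he0 (by norm_num)]; linarith
  rw [dist_eq_norm]
  have hkey : ‖s - q‖⁻¹ * (‖u s - u q‖ + ‖aff s - aff q‖) ≤ (25 / 23) * (D₀ + ‖a 0 - a 1‖) + ‖B‖ := by
    calc ‖s - q‖⁻¹ * (‖u s - u q‖ + ‖aff s - aff q‖)
        ≤ ‖s - q‖⁻¹ * (D₀ + (‖a 0 - a 1‖ + ‖B‖ * ‖s - q‖)) := by gcongr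
      _ = ‖s - q‖⁻¹ * (D₀ + ‖a 0 - a 1‖) + ‖B‖ * (‖s - q‖⁻¹ * ‖s - q‖) := by ring
      _ = ‖s - q‖⁻¹ * (D₀ + ‖a 0 - a 1‖) + ‖B‖ := by rw [inv_mul_cancel₀ he0.ne', mul_one]
      _ ≤ (25 / 23) * (D₀ + ‖a 0 - a 1‖) + ‖B‖ := by gcongr
  have hd0 : 0 ≤ ‖u s - u q‖ := norm_nonneg _
  calc 210000 * ‖s - q‖⁻¹ ^ 9 * (‖u s - u q‖ + ‖aff s - aff q‖) * ‖u s - u q‖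
      = 210000 * (‖s - q‖⁻¹ * (‖u s - u q‖ + ‖aff s - aff q‖)) * ‖s - q‖⁻¹ ^ 8 * ‖u s - u q‖ := by ring
    _ ≤ 210000 * ((25 / 23) * (D₀ + ‖a 0 - a 1‖) + ‖B‖) * ‖s - q‖⁻¹ ^ 8 * ‖u s - u q‖ := by gcongr

/-! ## The forcing: truncated self-force and cut-off tails -/

/-- **For a relaxed approximant the truncated self-force is a far tail**: if `Σ'_q F((s−q) + Dg) = 0`, then
`‖Σ_{q ∈ SR∖s} F((s−q) + Dg)‖ ≤ 31488·1024/((23/25)³ (r − dist s c)⁴)`. [folklore] -/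
theorem norm_selfForce_trunc_le (hA : Adm₀ A) (hI : Inner₀ t A)
    (haff : ∀ (m : Fin 2) (z : EuclideanSpace ℝ (Fin 3)), z ∈ Λ₀ → aff (t m + A z) = a m + B (t m + A z - x₀))
    (ha : ‖a 0 - a 1‖ ≤ 1 / 50) (hB : ‖B‖ ≤ 1 / 50)
    (s : Sites₀ t A) (hsr : 1 ≤ r - dist (s : EuclideanSpace ℝ (Fin 3)) c)
    (SR : Finset (EuclideanSpace ℝ (Fin 3))) (hSR : ∀ x, x ∈ SR ↔ x ∈ Sites₀ t A ∧ dist x c ≤ r)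
    (hrelax : (∑' q : Sites₀ t A, (if (s : EuclideanSpace ℝ (Fin 3)) ≠ q then
        𝐅[((s : EuclideanSpace ℝ (Fin 3)) - q) + (aff s - aff q)] else 0)) = 0) :
    ‖∑ q ∈ SR.erase s, 𝐅[((s : EuclideanSpace ℝ (Fin 3)) - q) + (aff s - aff q)]‖ ≤
      31488 * (1024 / ((23 / 25 : ℝ) ^ 3 * (r - dist (s : EuclideanSpace ℝ (Fin 3)) c) ^ 4)) := by
  obtain ⟨tail, htail, hsum⟩ := tsum_dispForce_eq_sum_add hA hI haff ha hB s hsr SR hSR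
  rw [hrelax] at hsum
  have : ∑ q ∈ SR.erase s, 𝐅[((s : EuclideanSpace ℝ (Fin 3)) - q) + (aff s - aff q)] = -tail :=
    eq_neg_of_add_eq_zero_left hsum.symm
  rw [this, norm_neg]
  exact htail

/-- **The far tail of the truncated operator**: `‖Σ'_{q ∉ SR} [s ≠ q] K(s−q) w‖ ≤ 38 ‖w‖ F₈(r − dist s c)` for
`r − dist s c ≥ 23/25` (sites outside `B_r(c)` are farther than `r − dist s c` from `s`). [folklore] -/
theorem norm_tsum_compl_le (hA : Adm₀ A) (hI : Inner₀ t A) {s : EuclideanSpace ℝ (Fin 3)} (hs : s ∈ Sites₀ t A)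
    {ϱ : ℝ} (hϱ : 23 / 25 ≤ ϱ) (hsr : ϱ ≤ r - dist s c)
    (SR : Finset (EuclideanSpace ℝ (Fin 3))) (hSR : ∀ x, x ∈ SR ↔ x ∈ Sites₀ t A ∧ dist x c ≤ r)
    (w : EuclideanSpace ℝ (Fin 3)) :
    ‖∑' q : ↑((SR.subtype (· ∈ Sites₀ t A) : Set (Sites₀ t A)))ᶜ,
        (if s ≠ (q : EuclideanSpace ℝ (Fin 3)) then 𝕂[s - (q : EuclideanSpace ℝ (Fin 3))] w else 0)‖ ≤
      38 * ‖w‖ * (1024 / ((23 / 25 : ℝ) ^ 3 * ϱ ^ 5)) := by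
  obtain ⟨hfs, hfle⟩ := summable_far_inv_pow_eight_sites hA hI s hϱ
  -- every site of the complement is farther than ϱ from s
  have hfar : ∀ q : ↑((SR.subtype (· ∈ Sites₀ t A) : Set (Sites₀ t A)))ᶜ,
      ϱ < dist ((q : Sites₀ t A) : EuclideanSpace ℝ (Fin 3)) s := by
    intro q
    have hq : (q : Sites₀ t A) ∉ (SR.subtype (· ∈ Sites₀ t A) : Set (Sites₀ t A)) := q.2
    have hq' : ((q : Sites₀ t A) : EuclideanSpace ℝ (Fin 3)) ∉ SR := by
      intro h; exact hq (by rw [Finset.mem_coe, Finset.mem_subtype]; exact h)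
    have hqr : r < dist ((q : Sites₀ t A) : EuclideanSpace ℝ (Fin 3)) c := by
      by_contra h; exact hq' ((hSR _).2 ⟨(q : Sites₀ t A).2, not_lt.1 h⟩)
    have := dist_triangle ((q : Sites₀ t A) : EuclideanSpace ℝ (Fin 3)) s c
    linarith
  have hbd : ∀ q : ↑((SR.subtype (· ∈ Sites₀ t A) : Set (Sites₀ t A)))ᶜ,
      ‖(if s ≠ ((q : Sites₀ t A) : EuclideanSpace ℝ (Fin 3)) then 𝕂[s - ((q : Sites₀ t A) : EuclideanSpace ℝ (Fin 3))] w else 0)‖ ≤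
        38 * ‖w‖ * (if ϱ < dist ((q : Sites₀ t A) : EuclideanSpace ℝ (Fin 3)) s then
          (dist ((q : Sites₀ t A) : EuclideanSpace ℝ (Fin 3)) s)⁻¹ ^ 8 else 0) := by
    intro q
    rw [if_pos (hfar q)]
    by_cases hsq : s ≠ ((q : Sites₀ t A) : EuclideanSpace ℝ (Fin 3))
    · rw [if_pos hsq]
      have hge := dist_sites_ge hA hI hs (q : Sites₀ t A).2 hsq
      have he : 9 / 10 ≤ ‖s - ((q : Sites₀ t A) : EuclideanSpace ℝ (Fin 3))‖ := by
        rw [← dist_eq_norm]; linarith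
      refine (norm_forceConst_apply_le he w).trans (le_of_eq ?_)
      rw [← dist_eq_norm, dist_comm]; ring
    · rw [if_neg hsq, norm_zero]; positivity
  have hs' := (hfs.mul_left (38 * ‖w‖)).subtype ((SR.subtype (· ∈ Sites₀ t A) : Set (Sites₀ t A)))ᶜ
  calc _ ≤ ∑' q : ↑((SR.subtype (· ∈ Sites₀ t A) : Set (Sites₀ t A)))ᶜ, 38 * ‖w‖ *
        (if ϱ < dist ((q : Sites₀ t A) : EuclideanSpace ℝ (Fin 3)) s then
          (dist ((q : Sites₀ t A) : EuclideanSpace ℝ (Fin 3)) s)⁻¹ ^ 8 else 0) := tsum_of_norm_bounded hs'.hasSum hbd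
    _ ≤ ∑' q : Sites₀ t A, 38 * ‖w‖ *
        (if ϱ < dist (q : EuclideanSpace ℝ (Fin 3)) s then (dist (q : EuclideanSpace ℝ (Fin 3)) s)⁻¹ ^ 8 else 0) :=
        Summable.tsum_subtype_le _ _ (fun q => by positivity) (hfs.mul_left (38 * ‖w‖))
    _ = 38 * ‖w‖ * ∑' q : Sites₀ t A,
        (if ϱ < dist (q : EuclideanSpace ℝ (Fin 3)) s then (dist (q : EuclideanSpace ℝ (Fin 3)) s)⁻¹ ^ 8 else 0) := tsum_mul_left
    _ ≤ 38 * ‖w‖ * (1024 / ((23 / 25 : ℝ) ^ 3 * ϱ ^ 5)) := by gcongr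

/-- **The cut-off tail over the ball**: if `1 − χ` vanishes at the sites `q ∈ SR` with `dist s q ≤ ϱ`
(`ϱ ≥ 23/25`), `|1 − χ| ≤ 1` and `‖u q‖ ≤ D` on `SR`, then
`‖Σ_{q ∈ SR∖s} K(s−q)((1 − χ q) u q)‖ ≤ 38 D F₈(ϱ)`. [folklore] -/
theorem norm_cutoffTail_le (hA : Adm₀ A) (hI : Inner₀ t A) {s : EuclideanSpace ℝ (Fin 3)} (hs : s ∈ Sites₀ t A)
    (SR : Finset (EuclideanSpace ℝ (Fin 3))) (hSRS : ∀ x ∈ SR, x ∈ Sites₀ t A)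
    (χ : EuclideanSpace ℝ (Fin 3) → ℝ) (hχ1 : ∀ x, |1 - χ x| ≤ 1) {ϱ D : ℝ} (hϱ : 23 / 25 ≤ ϱ) (hD : 0 ≤ D)
    (hχnear : ∀ q ∈ SR, dist s q ≤ ϱ → χ q = 1)
    (u : EuclideanSpace ℝ (Fin 3) → EuclideanSpace ℝ (Fin 3)) (hu : ∀ q ∈ SR, ‖u q‖ ≤ D) :
    ‖∑ q ∈ SR.erase s, 𝕂[s - q] ((1 - χ q) • u q)‖ ≤ 38 * D * (1024 / ((23 / 25 : ℝ) ^ 3 * ϱ ^ 5)) := by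
  obtain ⟨hfs, hfle⟩ := summable_far_inv_pow_eight_sites hA hI s hϱ
  have hmem : ∀ x ∈ SR.erase s, x ∈ Sites₀ t A := fun x hx => hSRS x (Finset.mem_erase.1 hx).2
  have hbd : ∀ q ∈ SR.erase s, ‖𝕂[s - q] ((1 - χ q) • u q)‖ ≤
      38 * D * (if ϱ < dist q s then (dist q s)⁻¹ ^ 8 else 0) := by
    intro q hq
    obtain ⟨hne, hqS⟩ := Finset.mem_erase.1 hq
    by_cases hnear : dist s q ≤ ϱ
    · rw [hχnear q hqS hnear, sub_self, zero_smul]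
      have : 𝕂[s - q] (0 : EuclideanSpace ℝ (Fin 3)) = 0 := by simp
      rw [this, norm_zero]; positivity
    · rw [if_pos (by rw [dist_comm]; exact lt_of_not_ge hnear)]
      have hge := dist_sites_ge hA hI hs (hSRS q hqS) (Ne.symm hne)
      have he : 9 / 10 ≤ ‖s - q‖ := by rw [← dist_eq_norm]; linarith
      refine (norm_forceConst_apply_le he _).trans ?_
      rw [norm_smul, Real.norm_eq_abs, ← dist_eq_norm, dist_comm]
      have h1 : |1 - χ q| * ‖u q‖ ≤ 1 * D := mul_le_mul (hχ1 q) (hu q hqS) (norm_nonneg _) zero_le_one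
      have h2 : 0 ≤ (dist q s)⁻¹ ^ 8 := by positivity
      nlinarith
  calc ‖∑ q ∈ SR.erase s, 𝕂[s - q] ((1 - χ q) • u q)‖
      ≤ ∑ q ∈ SR.erase s, ‖𝕂[s - q] ((1 - χ q) • u q)‖ := norm_sum_le _ _
    _ ≤ ∑ q ∈ SR.erase s, 38 * D * (if ϱ < dist q s then (dist q s)⁻¹ ^ 8 else 0) := Finset.sum_le_sum hbd
    _ = 38 * D * ∑ q ∈ SR.erase s, (if ϱ < dist q s then (dist q s)⁻¹ ^ 8 else 0) := by rw [Finset.mul_sum]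
    _ ≤ 38 * D * (1024 / ((23 / 25 : ℝ) ^ 3 * ϱ ^ 5)) := by
        refine mul_le_mul_of_nonneg_left ?_ (by positivity)
        refine le_trans ?_ hfle
        rw [← Finset.sum_subtype_of_mem (f := fun q => (if ϱ < dist q s then (dist q s)⁻¹ ^ 8 else 0)) hmem]
        exact hfs.sum_le_tsum _ fun q _ => by positivity

end

end Summit.AtomisticToContinuum.Crystallization.Theorems.ExcessDecayLiouville

end
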